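import Literature.AnabelianGeometry.SemiGraphs.TemperedReconstructionCor39LiteralFold
import Literature.AnabelianGeometry.SemiGraphs.TemperedCollapseFunctor
import Literature.AnabelianGeometry.SemiGraphs.TemperedReconstructionReductionsProofs
import Literature.AnabelianGeometry.SemiGraphs.TemperedCompactInVerticialFinite
import Literature.AnabelianGeometry.SemiGraphs.TemperedPiChartExists
import Literature.AnabelianGeometry.SemiGraphs.WitnessIwahoriBundle
import HarnessLib

/-!
# [SemiAnbd] Cor. 3.9 AS LITERALLY TYPED is false — second, independent witness: the COLLAPSE of the
# Iwahori loop graph onto its vertex group (row O-Cor39-1 of the abc-iut cell, part 3)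

Mochizuki, *Semi-graphs of anabelioids*, Publ. RIMS **42** (2006), §3, Cor. 3.9 p. 42, Def. 3.8 p. 42
[cite: MochizukiSemiAnbd2006, Cor 3.9 p.42].

At abc-iut-w5-d236's witness `𝓛 = IwahoriWitness.loopGraph p` (one vertex with `P = ℤ_p ⋊ (1+pℤ_p)`,
one ESTRANGED loop with `U = 1+pℤ_p`, branch subgroups the torus `T₀` and the twisted complement `T₁`;
`Cor39Hypotheses` kernel-checked in `WitnessIwahoriBundle`) we build the **fold** of `π₁^temp(𝓛)` onto its
vertex group: the collapse datum `κ := ((a,s) ↦ (pa,s))` (open image `pℤ_p ⋊ U`), `λ := b₀` (the torus),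
`τ_b := (−c_b, 0)` (so that `τ_b · T₀ · τ_b⁻¹ = κ(T_{c_b})`: the twisted complement is folded onto a
conjugate of the torus), the collapse homomorphism `ψ : π₁^temp(𝓛) → P` of `TemperedCollapseFunctor`, and
`φ := ι_v ∘ ψ` for a verticial homomorphism `ι_v`.  Then (`exists_collapseFold`): `φ` is quasi-geometric in the
LITERAL reading of Def. 3.8 — maximal compact = verticial subgroups (Thm 3.7 (iv) at the finite graph) go
onto open subgroups of verticial subgroups (`ψ ∘ ι_v ∼ κ`), and the nontrivial intersections of distinct
maximal compact subgroups = edge-like subgroups (Thm 3.7 (iv)) = conjugates of `ι_v(T₀)` go onto conjugates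
of `ι_v(T₀)` — while its range lies in the single verticial subgroup `ι_v(P)`.  By
`not_cor39_of_range_le` (`TemperedReconstructionCor39LiteralFold`): **`not_cor39_collapse : ¬ Cor39.{0}`**.

REFUTATION OF RECORD.  The literal `Cor39` was first refuted in the tree by abc-iut-f-175
(`IwahoriWitness.not_cor39`, `TemperedReconstructionCor39LiteralRefutation.lean`, FACT-LIST row F-1710:
the fold of the DOUBLE loop `𝒟₁ → 𝒢₁`).  The present file is an independent second witness by a different
mechanism — an ENDOMORPHISM of `π₁^temp(𝒢₁)` obtained from the generic collapse functor
(`TemperedCollapseFunctor`, `CollapseDatum`) and the generic reduction `not_cor39_of_range_le`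
(`TemperedReconstructionCor39LiteralFold`) — recorded because it closes those two files' purpose in the
kernel and because `exists_collapseFold` holds for EVERY chart of `𝒢₁` itself (no second graph).

What this does and does not say: the frozen named fact `ProfiniteSemiGraph.Cor39` — Cor. 3.9 with Def. 3.8
read literally ("SOME nontrivial intersection of two distinct maximal compact subgroups", finding t2g2-F1)
and with `Hom.Induces` — is refuted AS TYPED, choice-independently (no property of the chosen conjugators is
used); Cor. 3.9 in the compatible / up-to-twist reading is a THEOREM of the tree at finite graphs
(`cor39UpToTwistAt_of_finite`, abc-iut-w4-d080 et al.) and is untouched.  No side is taken on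
[IUTchIII] Cor. 3.12.
-/

noncomputable section

namespace Literature.AnabelianGeometry.SemiGraphs

open CategoryTheory Topology
open Literature.AlgebraicGeometry.Frobenioids (IsSlimGroup)

universe u

/-! ### Generic bookkeeping: conjugation and `MapsOntoOpenSubgroupOf` -/

section Conj

variable {G₁ : Type u} [Group G₁] {G₂ : Type u} [Group G₂] [TopologicalSpace G₂] [IsTopologicalGroup G₂]

omit [TopologicalSpace G₂] [IsTopologicalGroup G₂] in
/-- `f (g K g⁻¹) = f(g) f(K) f(g)⁻¹`. [folklore] -/
private theorem map_conj_map (f : G₁ →* G₂) (K : Subgroup G₁) (g : G₁) :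
    (K.map (MulAut.conj g).toMonoidHom).map f = (K.map f).map (MulAut.conj (f g)).toMonoidHom := by
  rw [Subgroup.map_map, Subgroup.map_map]
  congr 1
  ext x
  simp [MulAut.conj_apply, map_mul, map_inv]

omit [Group G₁] [Group G₂] [IsTopologicalGroup G₂] in
/-- Transport of relative openness along a homeomorphism: if `T ∩ M` is open in `M`, then `e(T) ∩ e(M)` is
open in `e(M)`. [folklore] -/
private theorem isOpen_preimage_image_of_homeomorph (e : G₂ ≃ₜ G₂) (T M : Set G₂)
    (h : IsOpen ((Subtype.val : M → G₂) ⁻¹' T)) :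
    IsOpen ((Subtype.val : e '' M → G₂) ⁻¹' (e '' T)) := by
  rw [isOpen_induced_iff] at h ⊢
  obtain ⟨U, hU, hUT⟩ := h
  refine ⟨e '' U, e.isOpenMap U hU, ?_⟩
  ext ⟨x, m, hm, rfl⟩
  have hm' : (⟨m, hm⟩ : M) ∈ (Subtype.val : M → G₂) ⁻¹' U ↔ (⟨m, hm⟩ : M) ∈ (Subtype.val : M → G₂) ⁻¹' T := by
    rw [hUT]
  simp only [Set.mem_preimage] at hm' ⊢
  rw [e.injective.mem_set_image, e.injective.mem_set_image]
  exact hm'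

omit [TopologicalSpace G₂] [IsTopologicalGroup G₂] in
/-- Composition of conjugations: `a (b S b⁻¹) a⁻¹ = (ab) S (ab)⁻¹`. [folklore] -/
private theorem map_conj_map_conj (S : Subgroup G₂) (a b : G₂) :
    (S.map (MulAut.conj b).toMonoidHom).map (MulAut.conj a).toMonoidHom =
      S.map (MulAut.conj (a * b)).toMonoidHom := by
  rw [Subgroup.map_map]
  congr 1
  ext x
  simp [MulAut.conj_apply, mul_assoc]

/-- **Openness bookkeeping for Def. 3.8**: if `f(K₁) = x S x⁻¹` for a subgroup `S ≤ M` open in `M`, then `f`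
maps `K₁` onto an open subgroup of `x M x⁻¹` (conjugation is a homeomorphism).
[cite: MochizukiSemiAnbd2006, Def 3.8 p.42] -/
theorem mapsOntoOpenSubgroupOf_of_map_eq (f : G₁ →* G₂) {K₁ : Subgroup G₁} {S M : Subgroup G₂} (x : G₂)
    (hSM : S ≤ M) (hopen : IsOpen ((Subtype.val : M → G₂) ⁻¹' (S : Set G₂)))
    (hx : K₁.map f = S.map (MulAut.conj x).toMonoidHom) :
    MapsOntoOpenSubgroupOf f K₁ (M.map (MulAut.conj x).toMonoidHom) := by
  refine ⟨?_, ?_⟩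
  · rw [hx]; exact Subgroup.map_mono hSM
  · have hT : (K₁.map f : Set G₂) = ((Homeomorph.mulLeft x).trans (Homeomorph.mulRight x⁻¹)) '' (S : Set G₂) := by
      rw [hx, Subgroup.coe_map]; rfl
    have hM : ((M.map (MulAut.conj x).toMonoidHom : Subgroup G₂) : Set G₂) = ((Homeomorph.mulLeft x).trans (Homeomorph.mulRight x⁻¹)) '' (M : Set G₂) := by
      rw [Subgroup.coe_map]; rfl
    have key := isOpen_preimage_image_of_homeomorph ((Homeomorph.mulLeft x).trans (Homeomorph.mulRight x⁻¹)) (S : Set G₂) (M : Set G₂) hopen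
    rw [← hT, ← hM] at key
    exact key

omit [Group G₁] [Group G₂] [IsTopologicalGroup G₂] in
/-- The image of an open set under a topological embedding `ι` is open in `range ι`.
[folklore] -/
private theorem isOpen_preimage_image_of_isEmbedding {X : Type u} [TopologicalSpace X] {ι : X → G₂}
    (hι : IsEmbedding ι) {W : Set X} (hW : IsOpen W) (M : Set G₂) (hM : M = Set.range ι) :
    IsOpen ((Subtype.val : M → G₂) ⁻¹' (ι '' W)) := by
  subst hM
  have h1 : ((Subtype.val : Set.range ι → G₂) ⁻¹' (ι '' W)) = hι.toHomeomorph '' W := by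
    ext ⟨y, x, rfl⟩
    simp only [Set.mem_preimage, Set.mem_image]
    constructor
    · rintro ⟨w, hw, hwx⟩
      exact ⟨w, hw, Subtype.ext (by simpa using hwx)⟩
    · rintro ⟨w, hw, hwx⟩
      exact ⟨w, hw, by simpa using congrArg Subtype.val hwx⟩
  rw [h1]
  exact hι.toHomeomorph.isOpenMap W hW

end Conj

/-! ### The fold datum of the Iwahori loop graph -/

namespace IwahoriWitness

variable (p : ℕ) [Fact p.Prime]

/-- Every edge of the bouquet `H_1` is closed (both branches abut to the vertex).
[cite: MochizukiSemiAnbd2006, §1 p.11] -/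
theorem loopGraph_isClosedEdge (e : (loopGraph p).graph.Edge) : (loopGraph p).graph.IsClosedEdge e := by
  obtain ⟨b₁, b₂, hne, h₁, h₂, -⟩ := (loopGraph p).graph.two_branches e
  exact SemiGraph.isClosedEdge_of_abuts hne h₁ h₂ rfl rfl

/-! ### The fold homomorphism and its literal quasi-geometricity -/

open ProfiniteSemiGraph

/-- **The fold of the Iwahori loop graph.**  For every chart `c` of `𝓛 = loopGraph p` there is a continuous
endomorphism `φ` of `π₁^temp(𝓛)` which is quasi-geometric in the LITERAL reading of Def. 3.8, whose range
lies in a verticial subgroup, while `π₁^temp(𝓛)` has two distinct maximal compact subgroups meeting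
nontrivially.  (`φ = ι_v ∘ ψ`, `ψ` the collapse homomorphism of the fold datum built in the proof.)
[cite: MochizukiSemiAnbd2006, Def 3.8 p.42] -/
theorem exists_collapseFold (c : TemperedPiChart (loopGraph p)) :
    ∃ φ : c.G →ₜ* c.G, IsQuasiGeometric φ ∧
      (∃ (v : (loopGraph p).graph.Vertex) (V : Subgroup c.G), V ∈ verticialSubgroups c v ∧
        φ.toMonoidHom.range ≤ V) ∧
      ∃ K₁ H₁ : Subgroup c.G, IsMaximalCompactSubgroup K₁ ∧ IsMaximalCompactSubgroup H₁ ∧ K₁ ≠ H₁ ∧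
        K₁ ⊓ H₁ ≠ ⊥ := by
  classical
  have h39 := loopGraph_cor39Hypotheses p
  have h37 : (loopGraph p).Thm37Hypotheses := h39.thm37Hypotheses
  haveI : T2Space c.G := c.t2Space
  haveI : SecondCountableTopology (Iw p) := (Iw.homeoProd (p := p)).secondCountableTopology
  haveI : Finite (loopGraph p).graph.Vertex := inferInstanceAs (Finite PUnit)
  haveI : Finite (loopGraph p).graph.Edge := inferInstanceAs (Finite (ULift (Fin 1)))
  have hP : IsTempered (Iw p) := IsTempered.of_profinite
  -- the endomorphism `κ : (a, s) ↦ (p a, s)` of `P`, its action on the complements, its open range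
  let κ₀ : Iw p →ₜ* Iw p :=
    { toFun := fun x => ⟨(p : ℤ_[p]) * x.a, x.s⟩
      map_one' := by ext <;> simp
      map_mul' := fun x y => by
        ext
        · simp only [Iw.mul_a]; ring
        · simp only [Iw.mul_s]
      continuous_toFun := (Iw.continuous_mk_iff (p := p)).2
        ⟨continuous_const.mul Iw.continuous_a, Iw.continuous_s⟩ }
  have hκ₀ : ∀ x : Iw p, κ₀ x = ⟨(p : ℤ_[p]) * x.a, x.s⟩ := fun _ => rfl
  have κ₀_bHom : ∀ (c : ℤ_[p]) (u : IwU p), κ₀ (Iw.bHom c u) = Iw.bHom ((p : ℤ_[p]) * c) u := by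
    intro c u
    rw [hκ₀]
    ext <;> simp [mul_left_comm, mul_assoc]
  have conj_bHom_zero : ∀ (c : ℤ_[p]) (u : IwU p),
      (⟨-c, 0⟩ : Iw p) * Iw.bHom 0 u * (⟨-c, 0⟩ : Iw p)⁻¹ = κ₀ (Iw.bHom c u) := by
    intro c u
    obtain ⟨hs, ha⟩ := Iw.conj_coords (⟨-c, 0⟩ : Iw p) (Iw.bHom 0 u)
    rw [κ₀_bHom]
    ext
    · rw [ha]; simp [w]; ring
    · rw [hs]; simp
  have hκ₀open : IsOpen (Set.range κ₀) := by
    have h : Set.range κ₀ = {x : Iw p | ‖x.a‖ < 1} := by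
      ext x
      constructor
      · rintro ⟨y, rfl⟩
        exact (PadicInt.norm_lt_one_iff_dvd _).2 (dvd_mul_right _ _)
      · intro hx
        obtain ⟨a', ha'⟩ := (PadicInt.norm_lt_one_iff_dvd x.a).1 hx
        exact ⟨⟨a', x.s⟩, by rw [hκ₀]; ext <;> simp [ha']⟩
    rw [h]
    exact (isOpen_lt continuous_norm continuous_const).preimage Iw.continuous_a
  -- the fold datum: `κ` at the vertex, the torus at the edge, the conjugators `(−c_b, 0)`
  let D : ProfiniteSemiGraph.CollapseDatum (loopGraph p) (Iw p) :=
    { κ := fun _ => κ₀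
      lam := fun _ => Iw.bHom 0
      τ := fun b _ _ => ⟨-(coeff p b), 0⟩
      comm := fun b v h x => by
        change _ = κ₀ (Iw.bHom (coeff p b) x)
        exact conj_bHom_zero (coeff p b) x }
  -- the torus branch
  let b₀ : (loopGraph p).graph.Branch := ⟨(0, false)⟩
  have coeff_b₀ : coeff p b₀ = 0 := by simp [coeff, b₀]
  -- the vertex, a verticial homomorphism `ι` and its range `V₀`
  let v₀ : (loopGraph p).graph.Vertex := PUnit.unit
  obtain ⟨V₀, ι, ⟨eι⟩, rfl⟩ := (verticialInjective_holds _ h37 c v₀).1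
  have hιV : IsVerticialHom c v₀ ι := ⟨eι⟩
  have hV₀ : ι.toMonoidHom.range ∈ verticialSubgroups c v₀ := ⟨ι, ⟨eι⟩, rfl⟩
  have hιinj : Function.Injective ι := (verticialInjective_holds _ h37 c v₀).2 ι hιV
  -- `ι` as a homomorphism of `P` (same map; instances of `P` itself)
  let ιP : Iw p →* c.G := ι.toMonoidHom
  have hιembP : IsEmbedding ιP := (ι.continuous.isClosedEmbedding hιinj).isEmbedding
  -- the collapse homomorphism `ψ`, with `ψ ∘ ι ∼ κ`
  obtain ⟨ψ, hψ⟩ := D.exists_collapseHom hP c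
  obtain ⟨g₀, hg₀⟩ := D.conj_κ_of_chartFunctor_iso hP c ψ hψ v₀ ι hιV
  have hg₀' : ∀ x : Iw p, ψ (ιP x) = g₀ * κ₀ x * g₀⁻¹ := hg₀
  -- the fold
  let φ : c.G →ₜ* c.G := ι.comp ψ
  -- Thm 3.7 (iv) at the finite graph
  have h4 := maximalCompactIffVerticialAt_of_finiteGraph (𝒢 := loopGraph p) h37 c
  have hmax : ∀ {v : (loopGraph p).graph.Vertex} {K : Subgroup c.G}, K ∈ verticialSubgroups c v →
      IsMaximalCompactSubgroup K := fun hK => (h4.1 _).2 ⟨_, hK⟩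
  -- `φ ∘ ι = Inn(ι g₀) ∘ ι ∘ κ`
  have hφι : φ.toMonoidHom.comp ιP =
      (MulAut.conj (ιP g₀)).toMonoidHom.comp (ιP.comp (κ₀).toMonoidHom) := by
    ext x
    change ιP (ψ (ιP x)) = ιP g₀ * ιP (κ₀ x) * (ιP g₀)⁻¹
    rw [hg₀' x, map_mul, map_mul, map_inv]
  -- the open piece `S := ι(κ P)` of `V₀` and the image of `V₀`
  let S : Subgroup c.G := ((κ₀).toMonoidHom.range).map ιP
  have hVφ : (ι.toMonoidHom.range).map φ.toMonoidHom = S.map (MulAut.conj (ιP g₀)).toMonoidHom := by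
    change ιP.range.map φ.toMonoidHom =
      (((κ₀).toMonoidHom.range).map ιP).map (MulAut.conj (ιP g₀)).toMonoidHom
    rw [MonoidHom.map_range, hφι, MonoidHom.map_range, MonoidHom.map_range]
  have hSM : S ≤ ι.toMonoidHom.range := Subgroup.map_le_range _ _
  have hSopen : IsOpen ((Subtype.val : ι.toMonoidHom.range → c.G) ⁻¹' (S : Set c.G)) := by
    have hS : (S : Set c.G) = ιP '' Set.range (κ₀) := by
      change (((κ₀).toMonoidHom.range).map ιP : Set c.G) = _
      rw [Subgroup.coe_map, MonoidHom.coe_range]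
      rfl
    rw [hS]
    exact isOpen_preimage_image_of_isEmbedding hιembP (hκ₀open) _ (MonoidHom.coe_range ιP)
  -- the base edge-like subgroup `L₀ := ι(T₀)`
  have hb₀ : (loopGraph p).graph.abuts b₀ = some v₀ := rfl
  let L₀ : Subgroup c.G := (ι.comp ((loopGraph p).brHom b₀ v₀ hb₀)).toMonoidHom.range
  have hL₀ : L₀ ∈ edgeLikeSubgroups c ((loopGraph p).graph.edgeOf b₀) :=
    ⟨_, isEdgeHom_comp_brHom c hb₀ hιV, rfl⟩
  have hL₀' : L₀ = (ιP.comp (Iw.bHom 0).toMonoidHom).range := by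
    change (ι.comp (Iw.bHom (coeff p b₀))).toMonoidHom.range = _
    rw [coeff_b₀]
    rfl
  have hL₀ne : L₀ ≠ ⊥ := by
    intro h0
    have hmem : ιP (Iw.bHom 0 ⟨1⟩) ∈ L₀ := by rw [hL₀']; exact ⟨⟨1⟩, rfl⟩
    rw [h0, Subgroup.mem_bot, ← map_one ιP] at hmem
    have h1 : Iw.bHom 0 (⟨1⟩ : IwU p) = 1 := hιinj hmem
    have h2 := congrArg Iw.s h1
    simp at h2
  -- `φ ∘ ι ∘ b₀ = Inn(ι g₀) ∘ ι ∘ b₀` (κ fixes the torus pointwise)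
  have hL₀φ : L₀.map φ.toMonoidHom = L₀.map (MulAut.conj (ιP g₀)).toMonoidHom := by
    have hcomp : φ.toMonoidHom.comp (ιP.comp (Iw.bHom (p := p) 0).toMonoidHom) =
        (MulAut.conj (ιP g₀)).toMonoidHom.comp (ιP.comp (Iw.bHom (p := p) 0).toMonoidHom) := by
      ext u
      change ιP (ψ (ιP (Iw.bHom 0 u))) = ιP g₀ * ιP (Iw.bHom 0 u) * (ιP g₀)⁻¹
      rw [hg₀', κ₀_bHom, mul_zero, map_mul, map_mul, map_inv]
    rw [hL₀', MonoidHom.map_range, MonoidHom.map_range, hcomp]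
  have hedge : ∀ e : (loopGraph p).graph.Edge, e = (loopGraph p).graph.edgeOf b₀ := by
    rintro ⟨⟨i, hi⟩⟩
    have : i = 0 := by omega
    subst this
    rfl
  refine ⟨φ, ⟨fun K hK => ?_, fun K₁ H₁ hK₁ hH₁ hne hint => ?_⟩, ⟨v₀, ι.toMonoidHom.range, hV₀, ?_⟩, ?_⟩
  · -- (maximal): `K = g V₀ g⁻¹` goes onto the open subgroup `x S x⁻¹` of `x V₀ x⁻¹`, `x = φ(g) ι(g₀)`
    obtain ⟨v, hKv⟩ := (h4.1 K).1 hK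
    obtain rfl : v = v₀ := rfl
    obtain ⟨g, rfl⟩ := exists_conj_of_mem_verticialSubgroups c hV₀ hKv
    refine ⟨_, hmax (conj_mem_verticialSubgroups c hV₀ (φ g * ιP g₀)),
      mapsOntoOpenSubgroupOf_of_map_eq φ.toMonoidHom (φ g * ιP g₀) hSM hSopen ?_⟩
    rw [map_conj_map, hVφ, map_conj_map_conj]
    rfl
  · -- (inter): `K₁ ⊓ H₁` is edge-like, a conjugate of `L₀`, and goes onto a conjugate of `L₀`
    obtain ⟨e, -, hLe⟩ := (h4.2 (K₁ ⊓ H₁) hint).1 ⟨K₁, H₁, hK₁, hH₁, hne, rfl⟩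
    obtain rfl := hedge e
    obtain ⟨g₁, hL⟩ := exists_conj_of_mem_edgeLikeSubgroups c hL₀ hLe
    let L₂ : Subgroup c.G := L₀.map (MulAut.conj (φ g₁ * ιP g₀)).toMonoidHom
    have hLφ : (K₁ ⊓ H₁).map φ.toMonoidHom = L₂ := by
      rw [hL, map_conj_map, hL₀φ, map_conj_map_conj]
      rfl
    have hL₂ : L₂ ∈ edgeLikeSubgroups c ((loopGraph p).graph.edgeOf b₀) :=
      conj_mem_edgeLikeSubgroups' c hL₀ _
    have hL₂ne : L₂ ≠ ⊥ := fun h0 =>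
      hL₀ne ((Subgroup.map_eq_bot_iff_of_injective L₀ (MulAut.conj (φ g₁ * ιP g₀)).injective).1 h0)
    obtain ⟨K₂, H₂, hK₂, hH₂, hne₂, hL₂eq⟩ :=
      (h4.2 L₂ hL₂ne).2 ⟨_, loopGraph_isClosedEdge p _, hL₂⟩
    refine ⟨K₂, H₂, hK₂, hH₂, hne₂, hL₂eq ▸ hL₂ne, ?_, ?_⟩
    · rw [hLφ, hL₂eq]
    · rw [hLφ, hL₂eq,
        show ((Subtype.val : (K₂ ⊓ H₂ : Subgroup c.G) → c.G) ⁻¹' ((K₂ ⊓ H₂ : Subgroup c.G) : Set c.G)) =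
          Set.univ from Set.eq_univ_of_forall fun y => y.2]
      exact isOpen_univ
  · -- the range of the fold lies in `V₀ = ι(P)`
    rintro _ ⟨y, rfl⟩
    exact ⟨ψ y, rfl⟩
  · -- two distinct maximal compact subgroups meeting in `L₀ ≠ 1`
    obtain ⟨K₁, H₁, hK₁, hH₁, hne, hL₀eq⟩ :=
      (h4.2 L₀ hL₀ne).2 ⟨_, loopGraph_isClosedEdge p _, hL₀⟩
    exact ⟨K₁, H₁, hK₁, hH₁, hne, hL₀eq ▸ hL₀ne⟩

/-! ### The refutation -/

/-- **[SemiAnbd] Cor. 3.9 AS LITERALLY TYPED (`ProfiniteSemiGraph.Cor39`, Def. 3.8 read literally, `Hom.Induces`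
with chosen conjugators) is FALSE**: the fold of the Iwahori loop graph (for `p = 2`, say) is a literally
quasi-geometric endomorphism of `π₁^temp` induced, even up to twist, by no locally open morphism.  The
compatible / up-to-twist Cor. 3.9 (`cor39UpToTwistAt_of_finite`) is a theorem and is what consumers bind.
[cite: MochizukiSemiAnbd2006, Cor 3.9 p.42] -/
theorem not_cor39_collapse : ¬ ProfiniteSemiGraph.Cor39.{0} := by
  haveI : Fact (Nat.Prime 2) := ⟨Nat.prime_two⟩
  haveI : Finite (loopGraph 2).graph.Vertex := inferInstanceAs (Finite PUnit)
  haveI : Finite (loopGraph 2).graph.Edge := inferInstanceAs (Finite (ULift (Fin 1)))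
  let c : TemperedPiChart (loopGraph 2) := (loopGraph 2).temperedPiChart (loopGraph_prop36Hypotheses 2)
  obtain ⟨φ, hqg, ⟨v, V, hV, hrange⟩, K₁, H₁, hK₁, hH₁, hne, hint⟩ := exists_collapseFold 2 c
  exact not_cor39_of_range_le (loopGraph_cor39Hypotheses 2) (loopGraph_cor39Hypotheses 2) c c φ hqg hV
    hrange hK₁ hH₁ hne hint

end IwahoriWitness

end Literature.AnabelianGeometry.SemiGraphs

end
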